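import Mathlib
import Summits.Ventures.PercRepro2.PMK5LocusFiveClass
import Summits.Ventures.PercRepro2.BlockSubstLaw

/-!
# THEOREM 24 on every graph with five terminals: the equality locus of (HCOV) is the five-class
locus of the `K₅` skeleton (blind cell PercRepro2, mine-2 g33)

For a block substitution of `K₅` (`IsBlockSubst ends K5.ends5 q blk Vj`, the marks
`o = q 0, a₁ = q 1, a₂ = q 2, a₃ = q 3, b = q 4`) the covariance form is the form of `K₅` at the
block weights (`Gc_blockSubst`), so THEOREM 24 (`K5.PM.gc_K5_pos_of_face` / `gc_K5_zero_of_face`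
with `RuleG = FiveClass`, `K5.PM.ruleG_eq_fiveClass`) reads the locus off the SKELETON MASK `m` —
the blocks that can connect their terminals — provided no block is surely connected:

* **`gc_fiveTerminal_pos_iff`**: `0 < Gc` iff `K₅(m)` is in none of the lead's five classes;
* **`gc_fiveTerminal_zero_iff`**: `Gc = 0` iff `K₅(m)` is in one of them;
* the one-directional forms `gc_fiveTerminal_pos_of_face` / `gc_fiveTerminal_zero_of_face`.

`K5.PM.FiveClass m` are the five classes on `K₅(m)` with `a₃ = 3, b = 4` (the `K₅` order).  The
cycle and necklace theorems of typer-1 g48 are the skeleton `C₅ ⊆ K₅`; their equality loci are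
instances.  Standard axioms only.
-/

namespace Summit.Ventures.PercRepro2

namespace BlockSubst

section FiveLocus

open K5 K5.PM

variable {V : Type*} {E : Type*} [Fintype E] [DecidableEq E] {R : Type*} [Field R]
  [LinearOrder R] [IsStrictOrderedRing R]
variable {ends : E → Sym2 V} {q : Fin 5 → V} {blk : E → Fin 10} {Vj : Fin 10 → Set V}

/-- **The zero side**: if the blocks outside the skeleton mask `m` cannot connect their terminals
and `K₅(m)` is in one of the five classes, the covariance form vanishes. -/
theorem gc_fiveTerminal_zero_of_face (hB : IsBlockSubst ends ends5 q blk Vj) (p : E → R) (m : ℕ)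
    (hm : m < 1024) (hr : FiveClass m = true)
    (hp₀ : ∀ j : Fin 10, m.testBit j = false → bsProb ends ends5 q blk p j = 0) :
    CovForm.Gc p ends (q 0) (q 1) (q 2) (q 3) (q 4) = 0 := by
  rw [Gc_blockSubst hB p 0 1 2 3 4]
  have h := ruleG_eq_fiveClass ⟨m, hm⟩
  simp only at h
  exact gc_K5_zero_of_face m hm (h.trans hr) _ hp₀

/-- **The positive side**: if the blocks of the skeleton mask `m` connect their terminals with
probability strictly between `0` and `1`, the other blocks never, and `K₅(m)` is in none of the
five classes, the covariance form is strictly positive. -/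
theorem gc_fiveTerminal_pos_of_face (hB : IsBlockSubst ends ends5 q blk Vj) (p : E → R) (m : ℕ)
    (hm : m < 1024) (hr : FiveClass m = false)
    (hp₁ : ∀ j : Fin 10, m.testBit j = true →
      0 < bsProb ends ends5 q blk p j ∧ bsProb ends ends5 q blk p j < 1)
    (hp₀ : ∀ j : Fin 10, m.testBit j = false → bsProb ends ends5 q blk p j = 0) :
    0 < CovForm.Gc p ends (q 0) (q 1) (q 2) (q 3) (q 4) := by
  rw [Gc_blockSubst hB p 0 1 2 3 4]
  have h := ruleG_eq_fiveClass ⟨m, hm⟩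
  simp only at h
  exact gc_K5_pos_of_face m hm (h.trans hr) _ hp₁ hp₀

/-- **THEOREM 24 on every graph with five terminals, positive side**: with `m` the skeleton mask
(the blocks of `m` connect their terminals with probability in `(0, 1)`, the others never),
`0 < Gc` iff `K₅(m)` is in none of the five classes. -/
theorem gc_fiveTerminal_pos_iff (hB : IsBlockSubst ends ends5 q blk Vj) (p : E → R) (m : ℕ)
    (hm : m < 1024)
    (hp₁ : ∀ j : Fin 10, m.testBit j = true →
      0 < bsProb ends ends5 q blk p j ∧ bsProb ends ends5 q blk p j < 1)
    (hp₀ : ∀ j : Fin 10, m.testBit j = false → bsProb ends ends5 q blk p j = 0) :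
    0 < CovForm.Gc p ends (q 0) (q 1) (q 2) (q 3) (q 4) ↔ FiveClass m = false := by
  constructor
  · intro h
    by_contra hF
    rw [Bool.not_eq_false] at hF
    rw [gc_fiveTerminal_zero_of_face hB p m hm hF hp₀] at h
    exact lt_irrefl _ h
  · intro hr
    exact gc_fiveTerminal_pos_of_face hB p m hm hr hp₁ hp₀

/-- **THEOREM 24 on every graph with five terminals, zero side**: with `m` the skeleton mask as
above, `Gc = 0` iff `K₅(m)` is in one of the five classes. -/
theorem gc_fiveTerminal_zero_iff (hB : IsBlockSubst ends ends5 q blk Vj) (p : E → R) (m : ℕ)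
    (hm : m < 1024)
    (hp₁ : ∀ j : Fin 10, m.testBit j = true →
      0 < bsProb ends ends5 q blk p j ∧ bsProb ends ends5 q blk p j < 1)
    (hp₀ : ∀ j : Fin 10, m.testBit j = false → bsProb ends ends5 q blk p j = 0) :
    CovForm.Gc p ends (q 0) (q 1) (q 2) (q 3) (q 4) = 0 ↔ FiveClass m = true := by
  constructor
  · intro h
    by_contra hF
    rw [Bool.not_eq_true] at hF
    have := gc_fiveTerminal_pos_of_face hB p m hm hF hp₁ hp₀
    rw [h] at this
    exact lt_irrefl _ this
  · intro hr
    exact gc_fiveTerminal_zero_of_face hB p m hm hr hp₀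

end FiveLocus

end BlockSubst

end Summit.Ventures.PercRepro2
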